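import Literature.MathematicalPhysics.QuantumFieldTheory.TphiSeminorm
import Literature.Analysis.Complex.AnalyticCharFunExpMoments
import Summits.HubbardSuperconductivity.HubbardSuperconductivity.Theorems.BalabanIRBirComplexStableXYRStubBondWeightDefect
import HarnessLib

/-!
# Crux `BirComplexStableXYR` (stmt-HubbardSuperconductivity-14845), line `fat-gaussian-defect-calculus`:
# stub W1 `stub_bondWeight_tphi_le` — the bond weight in the `T_φ` seminorm

Registered stub (lead c8, wave 14; skeleton `Cruxes/BirComplexStableXYR/Lines/fat_gaussian_defect_calculus.lean`),
helper (`--supports`) for the crux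
`Summit.HubbardSuperconductivity.HubbardSuperconductivity.Theses.BalabanIR.BirComplexStableXYR`.

**Statement.** The Fröhlich–Spencer representation carries the smoothed-box bond weights
`W_v(η) = ∫_{[-π,π]} φ_v(η - τ) dτ` (`φ_v` = Mathlib's `gaussianPDFReal 0 v`, variance `v ≠ 0`), viewed as
`ℂ`-valued functions of the real bond gradient `η`.  In the Bauerschmidt–Brydges–Slade seminorm
`‖F‖_{T_φ(𝔥),η} = Σ_{k ≤ N} (𝔥^k/k!) ‖D^k F(η)‖` (`tphiSeminorm`, `Literature/…/TphiSeminorm.lean`):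
for `0 ≤ 𝔥 ≤ √v/2`, `‖W_v‖_{T_φ(𝔥),η} ≤ 1 + 4𝔥/√v`.

**Proof.** (0) On `E = ℝ`, `‖iteratedFDeriv ℝ k F η‖ = ‖iteratedDeriv k F η‖`.  (1) Order `0`:
`0 ≤ W_v ≤ 1` (landed `smoothedBox_nonneg/le_one`).  (2) `W_v(s) = ∫_{s-π}^{s+π} φ_v` (landed
`smoothedBox_eq_setIntegral_cell`), so by the fundamental theorem of calculus `W_v' = G(· + π) - G(· - π)`
with `G(x) = φ_v(x)`, and `D^{k+1} W_v(η) = G^{(k)}(η + π) - G^{(k)}(η - π)` (translation invariance of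
`iteratedDeriv`).  (3) `G` is the restriction to `ℝ` of the entire function
`g(z) = (2πv)^{-1/2} e^{-z²/(2v)}`, whose real iterated derivatives are the restrictions of the complex ones
(`Literature.Analysis.Complex.iteratedDeriv_eq_of_eqOn_ofReal`); on the strip `|Im z| ≤ √v`,
`|g(z)| = (2πv)^{-1/2} e^{(Im z)² - (Re z)²)/(2v)} ≤ (2πv)^{-1/2} e^{1/2} ≤ v^{-1/2}` (as `e ≤ 2π`), so Cauchy's
estimate on circles of radius `√v` about real points (Mathlib
`Complex.norm_iteratedDeriv_le_of_forall_mem_sphere_norm_le`) gives `|g^{(k)}(x)| ≤ k! v^{-1/2} / (√v)^k`, whence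
`‖D^{k+1} W_v(η)‖ ≤ 2 (k+1)! / (√v)^{k+1}`.  (4) Summing, with `x = 𝔥/√v ≤ 1/2`:
`‖W_v‖_{T_φ} ≤ 1 + 2 Σ_{1 ≤ k ≤ N} x^k ≤ 1 + 2x/(1 - x) ≤ 1 + 4x`.  Elementary; no definition and no named
fact is introduced; sorry-free. [folklore: Fröhlich–Spencer, CMP 81 (1981) §3 (bond weights of the
vortex representation); Bauerschmidt–Brydges–Slade 2019, Def. 7.1.1 (the `T_φ` seminorm)]
-/

set_option linter.dupNamespace false -- `Summit.<S>.<S>.Theorems…` repeats the summit name (D-0017 layout)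

noncomputable section

namespace Summit.HubbardSuperconductivity.HubbardSuperconductivity.Theorems.FSUnfolding

open scoped BigOperators Nat
open Literature.MathematicalPhysics.QuantumFieldTheory MeasureTheory ProbabilityTheory

/-! ### Real restrictions of entire functions and Cauchy's estimate on a strip -/

/-- The real iterated derivatives of the restriction to `ℝ` of an entire function are the
restrictions of its complex iterated derivatives. [folklore] -/
theorem hsc_bw_iteratedDeriv_ofReal {g : ℂ → ℂ} (hg : Differentiable ℂ g) (k : ℕ) (x : ℝ) :
    iteratedDeriv k (fun t : ℝ => g t) x = iteratedDeriv k g x :=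
  Literature.Analysis.Complex.iteratedDeriv_eq_of_eqOn_ofReal isOpen_univ
    (fun t _ => hg.analyticAt (t : ℂ)) (f := fun t : ℝ => g t) (fun _ _ => rfl) k x (Set.mem_univ x)

/-- **Cauchy's estimate at real points from a strip bound**: if `g` is entire and `|g| ≤ C` on the
strip `|Im z| ≤ r` (`r > 0`), then `|g^{(k)}(x)| ≤ k! C / r^k` at every real `x` (circles of radius `r`
about real points lie in the strip). [folklore] -/
theorem hsc_bw_cauchy_strip {g : ℂ → ℂ} (hg : Differentiable ℂ g) {r C : ℝ} (hr : 0 < r)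
    (hC : ∀ z : ℂ, |z.im| ≤ r → ‖g z‖ ≤ C) (k : ℕ) (x : ℝ) :
    ‖iteratedDeriv k g x‖ ≤ k ! * C / r ^ k := by
  refine Complex.norm_iteratedDeriv_le_of_forall_mem_sphere_norm_le k hr hg.diffContOnCl ?_
  intro z hz
  apply hC
  have h1 : ‖z - x‖ = r := mem_sphere_iff_norm.1 hz
  have h2 : |(z - x).im| ≤ ‖z - x‖ := Complex.abs_im_le_norm _
  simpa [Complex.sub_im, Complex.ofReal_im] using h2.trans h1.le

/-! ### The entire Gaussian -/

/-- The numerical constant: `(2πv)^{-1/2} e^{1/2} ≤ v^{-1/2}` for `v > 0`, i.e. `e ≤ 2π`. [folklore] -/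
theorem hsc_bw_const_le {v : ℝ} (hv : 0 < v) :
    (Real.sqrt (2 * Real.pi * v))⁻¹ * Real.exp (1 / 2) ≤ (Real.sqrt v)⁻¹ := by
  have h2pi : 0 < Real.sqrt (2 * Real.pi) := Real.sqrt_pos.2 (by positivity)
  have hsv : 0 < Real.sqrt v := Real.sqrt_pos.2 hv
  have hexp : Real.exp (1 / 2) ≤ Real.sqrt (2 * Real.pi) := by
    rw [Real.le_sqrt (Real.exp_pos _).le (by positivity), sq, ← Real.exp_add, add_halves]
    nlinarith [Real.exp_one_lt_three, Real.pi_gt_three]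
  calc (Real.sqrt (2 * Real.pi * v))⁻¹ * Real.exp (1 / 2)
      = (Real.sqrt (2 * Real.pi))⁻¹ * (Real.sqrt v)⁻¹ * Real.exp (1 / 2) := by
        rw [Real.sqrt_mul (by positivity) v, mul_inv]
    _ ≤ (Real.sqrt (2 * Real.pi))⁻¹ * (Real.sqrt v)⁻¹ * Real.sqrt (2 * Real.pi) := by gcongr
    _ = (Real.sqrt v)⁻¹ := by field_simp

/-- **The entire Gaussian on the strip `|Im z| ≤ √v`**: `|(2πv)^{-1/2} e^{-z²/(2v)}| ≤ v^{-1/2}` there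
(`Re(-z²) = (Im z)² - (Re z)² ≤ v`, and `e^{1/2} ≤ (2π)^{1/2}`). [folklore] -/
theorem hsc_bw_gauss_norm_le (v : NNReal) (hv : v ≠ 0) (z : ℂ) (hz : |z.im| ≤ Real.sqrt v) :
    ‖(((Real.sqrt (2 * Real.pi * v))⁻¹ : ℝ) : ℂ) * Complex.exp (-z ^ 2 / (2 * ((v : ℝ) : ℂ)))‖ ≤
      (Real.sqrt v)⁻¹ := by
  have hvpos : (0 : ℝ) < v := NNReal.coe_pos.2 (pos_iff_ne_zero.2 hv)
  rw [norm_mul, Complex.norm_real, Real.norm_eq_abs, abs_of_nonneg (by positivity), Complex.norm_exp]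
  have hre : (-z ^ 2 / (2 * ((v : ℝ) : ℂ))).re = (z.im ^ 2 - z.re ^ 2) / (2 * v) := by
    have h2 : (2 * ((v : ℝ) : ℂ)) = ((2 * (v : ℝ) : ℝ) : ℂ) := by push_cast; ring
    rw [h2, Complex.div_ofReal_re, Complex.neg_re, sq, Complex.mul_re]
    ring
  have him : z.im ^ 2 ≤ v := by
    calc z.im ^ 2 = |z.im| ^ 2 := (sq_abs _).symm
      _ ≤ (Real.sqrt v) ^ 2 := pow_le_pow_left₀ (abs_nonneg _) hz 2
      _ = v := Real.sq_sqrt hvpos.le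
  have hre_le : (-z ^ 2 / (2 * ((v : ℝ) : ℂ))).re ≤ 1 / 2 := by
    rw [hre, div_le_iff₀ (by positivity : (0 : ℝ) < 2 * v)]
    nlinarith [sq_nonneg z.re]
  calc (Real.sqrt (2 * Real.pi * v))⁻¹ * Real.exp (-z ^ 2 / (2 * ((v : ℝ) : ℂ))).re
      ≤ (Real.sqrt (2 * Real.pi * v))⁻¹ * Real.exp (1 / 2) := by gcongr
    _ ≤ (Real.sqrt v)⁻¹ := hsc_bw_const_le hvpos

/-! ### The smoothed box: derivatives by the fundamental theorem of calculus -/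

/-- **Iterated derivatives of a moving-window integral.**  For a continuous `f : ℝ → ℝ` whose complex
cast `G = (f : ℝ → ℂ)` is smooth, the `(k+1)`-st derivative of `s ↦ ∫_{s-a}^{s+a} f` (cast to `ℂ`) at `η` is
`G^{(k)}(η + a) - G^{(k)}(η - a)` (FTC for the first derivative, then translation invariance).
[folklore] -/
theorem hsc_bw_iteratedDeriv_window (f : ℝ → ℝ) (hf : Continuous f) (G : ℝ → ℂ)
    (hG : ContDiff ℝ (⊤ : ℕ∞) G) (hGf : ∀ x, ((f x : ℝ) : ℂ) = G x) (a : ℝ) (k : ℕ) (η : ℝ) :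
    iteratedDeriv (k + 1) (fun s : ℝ => ((∫ u in (s - a)..(s + a), f u : ℝ) : ℂ)) η =
      iteratedDeriv k G (η + a) - iteratedDeriv k G (η - a) := by
  have hΦ : ∀ t, HasDerivAt (fun u => ∫ x in (0 : ℝ)..u, f x) (f t) t :=
    fun t => (hf.integral_hasStrictDerivAt 0 t).hasDerivAt
  have heq : (fun s : ℝ => ((∫ u in (s - a)..(s + a), f u : ℝ) : ℂ)) =
      fun s => (((∫ u in (0 : ℝ)..(s + a), f u) - ∫ u in (0 : ℝ)..(s - a), f u : ℝ) : ℂ) := by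
    funext s
    rw [intervalIntegral.integral_interval_sub_left (hf.intervalIntegrable _ _)
      (hf.intervalIntegrable _ _)]
  have hderiv : ∀ s, HasDerivAt (fun s : ℝ => ((∫ u in (s - a)..(s + a), f u : ℝ) : ℂ))
      (G (s + a) - G (s - a)) s := by
    intro s
    rw [heq, ← hGf, ← hGf, ← Complex.ofReal_sub]
    exact (((hΦ (s + a)).comp_add_const s a).sub ((hΦ (s - a)).comp_sub_const s a)).ofReal_comp
  have hd : deriv (fun s : ℝ => ((∫ u in (s - a)..(s + a), f u : ℝ) : ℂ)) =
      fun s => G (s + a) - G (s - a) := funext fun s => (hderiv s).deriv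
  rw [iteratedDeriv_succ', hd]
  have hca : ContDiff ℝ k (fun s : ℝ => G (s + a)) :=
    (hG.of_le (mod_cast le_top)).comp (contDiff_id.add contDiff_const)
  have hcs : ContDiff ℝ k (fun s : ℝ => G (s - a)) :=
    (hG.of_le (mod_cast le_top)).comp (contDiff_id.sub contDiff_const)
  rw [iteratedDeriv_fun_sub hca.contDiffAt hcs.contDiffAt, iteratedDeriv_comp_add_const k G a,
    iteratedDeriv_comp_sub_const k G a]

/-! ### The stub -/

/-- **stub W1 (M/L): the bond weight in the `T_φ` seminorm.**  The smoothed box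
`W_v(η) = ∫_{[−π,π]} φ_v(η−τ)dτ` is real-analytic with `W_v' (η) = φ_v(η+π) − φ_v(η−π)` and, by Cauchy's estimate
for the entire Gaussian on circles of radius `√v` about real points (`|φ_v^{(j)}| ≤ j!·v^{-1/2}·v^{-j/2}`, from
`|φ_v| ≤ (2πv)^{-1/2}e^{1/2} ≤ v^{-1/2}` on the strip `|Im z| ≤ √v`), `‖W_v‖_{T_φ(𝔥),η} ≤ 1 + 4𝔥/√v` for
`0 ≤ 𝔥 ≤ √v/2`: at `𝔥 = (Kc₀)^{-1/2} ≪ √v` the bond weights cost nothing in the norm of the fluctuation step.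
[folklore: Fröhlich–Spencer, CMP 81 (1981) §3; Bauerschmidt–Brydges–Slade 2019, Def. 7.1.1] -/
theorem stub_bondWeight_tphi_le :
    ∀ (v : NNReal), v ≠ 0 → ∀ (N : ℕ) (𝔥 : ℝ), 0 ≤ 𝔥 → 𝔥 ≤ Real.sqrt v / 2 → ∀ η : ℝ,
      tphiSeminorm N 𝔥 (fun s : ℝ =>
        ((∫ τ in Set.Icc (-Real.pi) Real.pi, ProbabilityTheory.gaussianPDFReal 0 v (s - τ) : ℝ) : ℂ)) η ≤
        1 + 4 * 𝔥 / Real.sqrt v := by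
  intro v hv N 𝔥 h𝔥 h𝔥le η
  have hvpos : (0 : ℝ) < v := NNReal.coe_pos.2 (pos_iff_ne_zero.2 hv)
  have hrpos : 0 < Real.sqrt v := Real.sqrt_pos.2 hvpos
  -- the entire Gaussian `g` and its restriction to `ℝ`
  obtain ⟨g, hgdef⟩ : ∃ g : ℂ → ℂ, g = fun z => (((Real.sqrt (2 * Real.pi * v))⁻¹ : ℝ) : ℂ) *
      Complex.exp (-z ^ 2 / (2 * ((v : ℝ) : ℂ))) := ⟨_, rfl⟩
  have hg : Differentiable ℂ g := by
    rw [hgdef]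
    exact (((differentiable_pow 2).neg.div_const _).cexp).const_mul _
  have hgφ : ∀ x : ℝ, ((gaussianPDFReal 0 v x : ℝ) : ℂ) = g x := by
    intro x
    rw [hgdef]
    simp only [gaussianPDFReal, sub_zero]
    push_cast
    ring
  have hφcont : Continuous (gaussianPDFReal 0 v) := by
    rw [gaussianPDFReal_def]
    fun_prop
  have hG : ContDiff ℝ (⊤ : ℕ∞) (fun x : ℝ => g x) := by
    have h := ((hg.contDiff (n := ((⊤ : ℕ∞) : WithTop ℕ∞))).restrict_scalars ℝ).comp
      Complex.ofRealCLM.contDiff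
    simpa [Function.comp_def] using h
  have hbound : ∀ z : ℂ, |z.im| ≤ Real.sqrt v → ‖g z‖ ≤ (Real.sqrt v)⁻¹ := by
    intro z hz
    rw [hgdef]
    exact hsc_bw_gauss_norm_le v hv z hz
  have hcauchy : ∀ (k : ℕ) (x : ℝ),
      ‖iteratedDeriv k g x‖ ≤ k ! * (Real.sqrt v)⁻¹ / (Real.sqrt v) ^ k :=
    fun k x => hsc_bw_cauchy_strip hg hrpos hbound k x
  -- the smoothed box as a moving-window integral
  have hfun : (fun s : ℝ =>
      ((∫ τ in Set.Icc (-Real.pi) Real.pi, gaussianPDFReal 0 v (s - τ) : ℝ) : ℂ)) =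
      fun s : ℝ => ((∫ u in (s - Real.pi)..(s + Real.pi), gaussianPDFReal 0 v u : ℝ) : ℂ) := by
    funext s
    have h := smoothedBox_eq_setIntegral_cell v s 0
    simp only [Int.cast_zero, mul_zero, sub_zero] at h
    rw [h, intervalIntegral.integral_of_le (by linarith [Real.pi_pos])]
  -- derivative bounds of positive order
  have hderiv : ∀ k : ℕ, ‖iteratedFDeriv ℝ (k + 1) (fun s : ℝ =>
      ((∫ τ in Set.Icc (-Real.pi) Real.pi, gaussianPDFReal 0 v (s - τ) : ℝ) : ℂ)) η‖ ≤
      2 * ((k + 1)! : ℝ) / (Real.sqrt v) ^ (k + 1) := by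
    intro k
    rw [hfun, norm_iteratedFDeriv_eq_norm_iteratedDeriv,
      hsc_bw_iteratedDeriv_window (gaussianPDFReal 0 v) hφcont (fun x : ℝ => g x) hG hgφ Real.pi k η,
      hsc_bw_iteratedDeriv_ofReal hg k, hsc_bw_iteratedDeriv_ofReal hg k]
    have h1 := hcauchy k (η + Real.pi)
    have h2 := hcauchy k (η - Real.pi)
    have hk1 : (k ! : ℝ) * (Real.sqrt v)⁻¹ / (Real.sqrt v) ^ k = k ! / (Real.sqrt v) ^ (k + 1) := by
      rw [pow_succ]
      field_simp
    rw [hk1] at h1 h2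
    have hfac : (k ! : ℝ) ≤ ((k + 1)! : ℝ) := by exact_mod_cast Nat.factorial_le (Nat.le_succ k)
    calc ‖iteratedDeriv k g ↑(η + Real.pi) - iteratedDeriv k g ↑(η - Real.pi)‖
        ≤ ‖iteratedDeriv k g ↑(η + Real.pi)‖ + ‖iteratedDeriv k g ↑(η - Real.pi)‖ := norm_sub_le _ _
      _ ≤ k ! / (Real.sqrt v) ^ (k + 1) + k ! / (Real.sqrt v) ^ (k + 1) := add_le_add h1 h2
      _ = 2 * (k ! : ℝ) / (Real.sqrt v) ^ (k + 1) := by ring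
      _ ≤ 2 * ((k + 1)! : ℝ) / (Real.sqrt v) ^ (k + 1) := by gcongr
  -- order zero
  have h0 : ‖((∫ τ in Set.Icc (-Real.pi) Real.pi, gaussianPDFReal 0 v (η - τ) : ℝ) : ℂ)‖ ≤ 1 := by
    have hn := smoothedBox_nonneg v η 0
    have hl := smoothedBox_le_one v hv η 0
    simp only [Int.cast_zero, mul_zero, sub_zero] at hn hl
    rw [Complex.norm_real, Real.norm_eq_abs, abs_le]
    constructor <;> linarith
  -- the sum
  have hx0 : 0 ≤ 𝔥 / Real.sqrt v := div_nonneg h𝔥 hrpos.le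
  have hx1 : 𝔥 / Real.sqrt v ≤ 1 / 2 := by
    rw [div_le_iff₀ hrpos]
    linarith
  have hterm : ∀ k ∈ Finset.range N, 𝔥 ^ (k + 1) / ((k + 1)! : ℝ) *
      ‖iteratedFDeriv ℝ (k + 1) (fun s : ℝ =>
        ((∫ τ in Set.Icc (-Real.pi) Real.pi, gaussianPDFReal 0 v (s - τ) : ℝ) : ℂ)) η‖ ≤
      2 * (𝔥 / Real.sqrt v) * (𝔥 / Real.sqrt v) ^ k := by
    intro k _
    have hne : Real.sqrt v ≠ 0 := hrpos.ne'
    have hfne : ((k + 1)! : ℝ) ≠ 0 := by positivity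
    calc 𝔥 ^ (k + 1) / ((k + 1)! : ℝ) * ‖iteratedFDeriv ℝ (k + 1) (fun s : ℝ =>
          ((∫ τ in Set.Icc (-Real.pi) Real.pi, gaussianPDFReal 0 v (s - τ) : ℝ) : ℂ)) η‖
        ≤ 𝔥 ^ (k + 1) / ((k + 1)! : ℝ) * (2 * ((k + 1)! : ℝ) / (Real.sqrt v) ^ (k + 1)) :=
          mul_le_mul_of_nonneg_left (hderiv k) (by positivity)
      _ = 2 * (𝔥 / Real.sqrt v) ^ (k + 1) := by
          rw [div_pow]
          field_simp
      _ = 2 * (𝔥 / Real.sqrt v) * (𝔥 / Real.sqrt v) ^ k := by ring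
  have hgeom : ∑ k ∈ Finset.range N, (𝔥 / Real.sqrt v) ^ k ≤ 1 / (1 - 𝔥 / Real.sqrt v) := by
    have h := (geom_sum_Ico_le_of_lt_one hx0 (by linarith) :
      ∑ i ∈ Finset.Ico 0 N, (𝔥 / Real.sqrt v) ^ i ≤ (𝔥 / Real.sqrt v) ^ 0 / (1 - 𝔥 / Real.sqrt v))
    rwa [pow_zero, ← Finset.range_eq_Ico] at h
  have hinv : 1 / (1 - 𝔥 / Real.sqrt v) ≤ 2 := by
    rw [div_le_iff₀ (by linarith)]
    linarith
  rw [tphiSeminorm_eq_norm_add]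
  refine le_trans (add_le_add h0 (Finset.sum_le_sum hterm)) ?_
  rw [← Finset.mul_sum]
  calc 1 + 2 * (𝔥 / Real.sqrt v) * ∑ k ∈ Finset.range N, (𝔥 / Real.sqrt v) ^ k
      ≤ 1 + 2 * (𝔥 / Real.sqrt v) * (1 / (1 - 𝔥 / Real.sqrt v)) := by gcongr
    _ ≤ 1 + 2 * (𝔥 / Real.sqrt v) * 2 := by gcongr
    _ = 1 + 4 * 𝔥 / Real.sqrt v := by ring

end Summit.HubbardSuperconductivity.HubbardSuperconductivity.Theorems.FSUnfolding

end
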